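import Summits.ResolutionOfSingularities.ResolutionOfSingularities.Theorems.RadicialJungCleanModelsWoundLocusClosed
import HarnessLib

/-!
# Route `RadicialJung`, crux `CleanModels` (stmt-15917): the regular-type locus of a unit representative is open and dense

Support lemma (OURS) for `stub_cleanModels` = crux `RadicialJung.CleanModels` (stmt-15917; line
`via-clean-models` of `DescentPerfectToAll`, W8.1), PROGRAMME-clean-dim2 K3/K4 glue: the bridge
between the WOUND predicate of `RadicialJungCleanModelsWoundLocusClosed.lean` and the REGULAR-TYPE
clause of the crux `CleanModels` (verbatim: a unit `u₀` with
`(∀ c, u₀ - c^p ∉ 𝔪) ∨ (∃ c, u₀ - c^p ∈ 𝔪 ∧ u₀ - c^p ∉ 𝔪²)`).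

* `forall_sub_pow_not_mem_sq_iff_regularType` — in any local ring and for any `p ≥ 2`:
  `u` is UNWOUNDED (`∀ c, u - c^p ∉ 𝔪²`) iff `u` is of REGULAR TYPE
  (`(∀ c, u - c^p ∉ 𝔪) ∨ (∃ c, u - c^p ∈ 𝔪 ∖ 𝔪²)`): if `u - c₀^p ∈ 𝔪 ∖ 𝔪²` then for every `c`,
  `u - c^p = (u - c₀^p) + (c₀ - c)^p` is a unit (`c₀ - c ∉ 𝔪`) or `≡ u - c₀^p (mod 𝔪²)`
  (`c₀ - c ∈ 𝔪`, `p ≥ 2`).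
* `isOpen_setOf_regularType_stalk` — on an integral regular scheme locally of finite type over a
  field of characteristic `p`, the set of points at which a global section `u` is of regular type
  is OPEN (complement = the wound locus, closed by `isClosed_setOf_wound_stalk`), and
  `genericPoint_mem_setOf_regularType_stalk` — it contains the generic point when `u` is not a
  `p`-th power there (so it is dense: the unit-type clean locus of a fixed representative is a
  dense open, its complement finitely many curves and points on a surface).

Nothing here is a statement of Hironaka's manuscript or bears on the summit. [folklore]
-/

noncomputable section

set_option linter.dupNamespace false -- mandated namespace of this single-conjunct summit

open CategoryTheory AlgebraicGeometry TopologicalSpace IsLocalRing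
open Literature.AlgebraicGeometry.Resolution

namespace Summit.ResolutionOfSingularities.ResolutionOfSingularities.Theorems.RadicialJung.CleanModels

/-- **Unwounded ⟺ regular type** (characteristic `p`). In a local ring `O` of prime
characteristic `p`: `(∀ c, u - c^p ∉ 𝔪²)` iff `(∀ c, u - c^p ∉ 𝔪) ∨ (∃ c, u - c^p ∈ 𝔪 ∧ u - c^p ∉ 𝔪²)`.
(The characteristic is needed: in `ℚ⟦t⟧` with `p = 2`, `u = 1 + t` has `u - 1 ∈ 𝔪 ∖ 𝔪²` but
`u - (1 + t/2)² ∈ 𝔪²`.) [folklore] -/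
theorem forall_sub_pow_not_mem_sq_iff_regularType {O : Type} [CommRing O] [IsLocalRing O]
    (p : ℕ) [Fact p.Prime] [CharP O p] (u : O) :
    (∀ c : O, u - c ^ p ∉ maximalIdeal O ^ 2) ↔
      ((∀ c : O, u - c ^ p ∉ maximalIdeal O) ∨
        (∃ c : O, u - c ^ p ∈ maximalIdeal O ∧ u - c ^ p ∉ maximalIdeal O ^ 2)) := by
  have hp : p.Prime := Fact.out
  constructor
  · intro h
    by_cases h1 : ∀ c : O, u - c ^ p ∉ maximalIdeal O
    · exact Or.inl h1
    · push Not at h1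
      obtain ⟨c, hc⟩ := h1
      exact Or.inr ⟨c, hc, h c⟩
  · rintro (h | ⟨c₀, hc₀, hc₀2⟩) c hc
    · exact h c (Ideal.pow_le_self two_ne_zero hc)
    · have key : u - c ^ p = (u - c₀ ^ p) + (c₀ - c) ^ p := by
        rw [sub_pow_char c₀ c]; ring
      by_cases hcc : c₀ - c ∈ maximalIdeal O
      · -- `(c₀ - c)^p ∈ 𝔪^p ⊆ 𝔪²`, so `u - c₀^p ∈ 𝔪²`: contradiction
        apply hc₀2
        have h2 : (c₀ - c) ^ p ∈ maximalIdeal O ^ 2 :=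
          Ideal.pow_le_pow_right hp.two_le (Ideal.pow_mem_pow hcc p)
        have h3 : u - c₀ ^ p = (u - c ^ p) - (c₀ - c) ^ p := by rw [key]; ring
        rw [h3]
        exact Ideal.sub_mem _ hc h2
      · -- `(c₀ - c)^p` is a unit and `u - c₀^p ∈ 𝔪`, so `u - c^p` is a unit: contradiction
        have hunit : IsUnit ((c₀ - c) ^ p) :=
          ((IsLocalRing.notMem_maximalIdeal).mp hcc).pow p
        have hmem : u - c ^ p ∈ maximalIdeal O := Ideal.pow_le_self two_ne_zero hc
        apply (IsLocalRing.notMem_maximalIdeal).mpr hunit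
        have h4 : (c₀ - c) ^ p = (u - c ^ p) - (u - c₀ ^ p) := by rw [key]; ring
        rw [h4]
        exact Ideal.sub_mem _ hmem hc₀

/-- **The regular-type locus of a global section is open.** For an integral regular scheme `Y`
locally of finite type over a field of characteristic `p` and `u ∈ Γ(Y, 𝒪_Y)`, the set of points
`y` at which `u` is of regular type in `𝒪_{Y,y}` (the unit clause of `RadicialJung.CleanModels`)
is open: its complement is the wound locus (`isClosed_setOf_wound_stalk`). [folklore] -/
theorem isOpen_setOf_regularType_stalk {p : ℕ} [Fact p.Prime] {k : Type} [Field k] [CharP k p]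
    {Y : Scheme.{0}} [IsIntegral Y] (q : Y ⟶ Spec (.of k)) [LocallyOfFiniteType q]
    (hY : Scheme.IsRegular Y) (u : Γ(Y, ⊤)) :
    IsOpen {y : Y |
      (∀ c : Y.presheaf.stalk y,
          (Y.presheaf.germ ⊤ y trivial).hom u - c ^ p ∉ maximalIdeal (Y.presheaf.stalk y)) ∨
        ∃ c : Y.presheaf.stalk y,
          (Y.presheaf.germ ⊤ y trivial).hom u - c ^ p ∈ maximalIdeal (Y.presheaf.stalk y) ∧
            (Y.presheaf.germ ⊤ y trivial).hom u - c ^ p ∉ maximalIdeal (Y.presheaf.stalk y) ^ 2} := by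
  have hchar : ∀ y : Y, CharP (Y.presheaf.stalk y) p := fun y => by
    let φ : k →+* Y.presheaf.stalk y := (Y.presheaf.germ ⊤ y trivial).hom.comp
      ((q.appTop).hom.comp (Scheme.ΓSpecIso (.of k)).inv.hom)
    exact (φ.charP_iff_charP p).mp inferInstance
  have heq : {y : Y |
      (∀ c : Y.presheaf.stalk y,
          (Y.presheaf.germ ⊤ y trivial).hom u - c ^ p ∉ maximalIdeal (Y.presheaf.stalk y)) ∨
        ∃ c : Y.presheaf.stalk y,
          (Y.presheaf.germ ⊤ y trivial).hom u - c ^ p ∈ maximalIdeal (Y.presheaf.stalk y) ∧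
            (Y.presheaf.germ ⊤ y trivial).hom u - c ^ p ∉ maximalIdeal (Y.presheaf.stalk y) ^ 2} =
      {y : Y | ∃ c : Y.presheaf.stalk y,
        (Y.presheaf.germ ⊤ y trivial).hom u - c ^ p ∈ maximalIdeal (Y.presheaf.stalk y) ^ 2}ᶜ := by
    ext y
    haveI := hchar y
    rw [Set.mem_compl_iff, Set.mem_setOf_eq, Set.mem_setOf_eq,
      ← forall_sub_pow_not_mem_sq_iff_regularType p]
    simp only [not_exists]
  rw [heq, isOpen_compl_iff]
  exact isClosed_setOf_wound_stalk q hY u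

/-- … and it contains the generic point when `u` is not a `p`-th power there (regular type (i):
the maximal ideal of the function field is zero), hence is DENSE. [folklore] -/
theorem genericPoint_mem_setOf_regularType_stalk {p : ℕ} {Y : Scheme.{0}} [IsIntegral Y]
    (u : Γ(Y, ⊤)) (hu : ∀ c : Y.presheaf.stalk (genericPoint Y),
      (Y.presheaf.germ ⊤ (genericPoint Y) trivial).hom u ≠ c ^ p) :
    genericPoint Y ∈ {y : Y |
      (∀ c : Y.presheaf.stalk y,
          (Y.presheaf.germ ⊤ y trivial).hom u - c ^ p ∉ maximalIdeal (Y.presheaf.stalk y)) ∨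
        ∃ c : Y.presheaf.stalk y,
          (Y.presheaf.germ ⊤ y trivial).hom u - c ^ p ∈ maximalIdeal (Y.presheaf.stalk y) ∧
            (Y.presheaf.germ ⊤ y trivial).hom u - c ^ p ∉ maximalIdeal (Y.presheaf.stalk y) ^ 2} := by
  left
  intro c hc
  have hfield : maximalIdeal Y.functionField = ⊥ :=
    IsLocalRing.isField_iff_maximalIdeal_eq.mp (Field.toIsField Y.functionField)
  have hc' : (Y.presheaf.germ ⊤ (genericPoint Y) trivial).hom u - c ^ p ∈
      maximalIdeal Y.functionField := hc
  rw [hfield, Ideal.mem_bot, sub_eq_zero] at hc'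
  exact hu c hc'

end Summit.ResolutionOfSingularities.ResolutionOfSingularities.Theorems.RadicialJung.CleanModels

end
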